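import Summits.ResolutionOfSingularities.ResolutionOfSingularities.Theorems.FrobeniusClosingPatchingRelPerfectConeMemberLevelTwo
import Summits.ResolutionOfSingularities.ResolutionOfSingularities.Theorems.FrobeniusClosingPatchingRelPerfectCoreRungClosure
import Summits.ResolutionOfSingularities.ResolutionOfSingularities.Theorems.FrobeniusClosingPatchingRelPerfectCoreRungReductions
import HarnessLib

/-!
# Crux `PatchingRelPerfect` (stmt-ResolutionOfSingularities-16161), chain w52 — CORE RUNG r2pt:
# the quadric-CONE member `I = (x₀³, x₁³, x₂³, x₃³, x₀x₁ + x₂²)` has a companion (a tower of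
# three regular centres above `Bl_𝔪`), kernel-checked

[OURS · L1 W5.2 · rung] CHAIN.md v1.2 §2 (row stub-3), typed target `TargetR2pt` of plan-1's
`ChainW52TargetsC.lean`: for every regular local `S` with regular system of parameters
`x₀, x₁, x₂, x₃` (every characteristic, every residue field) and
`I = (x₀³, x₁³, x₂³, x₃³, q)`, `q = x₀x₁ + x₂²`, every blowing up `T = Bl_I Spec S` satisfies the
conclusion of the blow-up-form open core `stub_atomDimFourBlowup` / `CoreBlowupFormAt S I`.  This
is the first member of the `𝔪`-primary hunt family whose initial form is SINGULAR (the quadric cone,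
vertex `z₀ = [0:0:0:1] ∈ E ≅ ℙ³`), where the companion `𝔪` of the tangent-cone rung r1t fails.
Proof: `I` is a sup-reduction of `K = (q) + 𝔪³` (`(xᵢ³) 𝔪⁶ = 𝔪⁹`, r1a's pigeonhole; r1d
`coreRung_sup_reduction_of_companion`), and `K` has the companion
`Q = 𝔪 · Q₀`, `Q₀ = (P + 𝔪²)(P² + 𝔪³)`, `P = (x₀, x₁, x₂)`: the blowing up of `Spec S` along
`K Q₀ 𝔪` is `Bl_𝔪` followed, on the vertex chart, by the blowing ups of the vertex `z₀`, of the
plane `W₀ = E_{z₀} ∩ E^{st}`, and of the strict transform of the cone — regular centres in regular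
schemes (parts 1a–2c: `…ConeMemberChartIdeals`, `…LevelOne`, `…LevelTwoIdeals`, `…LevelTwo`,
`…LevelThree`), assembled chart by chart (`isRegular_of_isBlowup_mul_of_charts`, Stacks 080A).
PROVED here:

* `isRegular_of_isBlowup_map_KQ_three` — the vertex chart (instantiating the abstract level two
  with `A = B₃`, `t = x₃/1`, `v_k = x_k/x₃`);
* `isRegular_of_isBlowup_KQM` — every blowing up of `Spec S` along `K · Q₀ · 𝔪` is regular;
  `companion_coneK` — `K ∈ 𝒞` (companion `Q₀ 𝔪 ⊇ 𝔪⁶`);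
* `coreRung_cubesPlus_cone` — the rung (with `hd : spanFinrank 𝔪 = 4`),
  `coreRung_cubesPlus_cone_of_ringKrullDim` — the `TargetR2pt` shape (`ringKrullDim S = 4`), and
  `atomDimFourBlowupAt_cubesPlus_cone` — the registered core's binder shape restricted to the
  member.

BC5-type FORMAT evidence for the core on the first singular-initial-form member; nothing here is a
statement of the manuscript under review.

## References

* The Stacks Project, Tags 080A, 080B, 0804, 0BIQ. [StacksProject]
* Q. Liu, *Algebraic Geometry and Arithmetic Curves*, OUP 2002, Thm. 8.1.19 (a). [Liu2002]
* H. Matsumura, *Commutative Ring Theory*, CUP 1986, Thms. 14.2, 16.2, 16.3. [Matsumura1987]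
-/

-- `Summit.<Summit>.<Sub>.Theorems` with `Sub = Summit` (single-conjunct summit, D-0017)
set_option linter.dupNamespace false

noncomputable section

open CategoryTheory CategoryTheory.Limits AlgebraicGeometry Literature.AlgebraicGeometry.Resolution
open IsLocalRing

namespace Summit.ResolutionOfSingularities.ResolutionOfSingularities.Theorems

namespace ConeRung

universe u

/-- `castSucc k ≠ 3` in `Fin 4` for `k : Fin 3`. [folklore] -/
theorem castSucc_ne_three (k : Fin 3) : (Fin.castSucc k : Fin 4) ≠ 3 :=
  (Fin.castSucc_lt_last k).ne

section Vertex

variable {S : Type u} [CommRing S] [IsRegularLocalRing S] (x : Fin 4 → S)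
  (hx : Ideal.span (Set.range x) = IsLocalRing.maximalIdeal S)
  (hd : (IsLocalRing.maximalIdeal S).spanFinrank = 4)

local notation3 "M" => Ideal.span (Set.range x)
local notation3 "KK" => Ideal.span {x 0 * x 1 + x 2 ^ 2} ⊔ Ideal.span (Set.range x) ^ 3
local notation3 "PP" => Ideal.span {x 0, x 1, x 2}
local notation3 "QQ" => (PP ⊔ M ^ 2) * (PP ^ 2 ⊔ M ^ 3)
/-- the vertex chart `B = B₃` and the family `c = (u, e₀, e₁, e₂)` -/
local notation3 "B" => chartRing x 3
local notation3 "uu" => chartBase x 3 (x 3)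
local notation3 "jJ3" =>
  (fun k : Fin 3 => (⟨Fin.castSucc k, castSucc_ne_three k⟩ : {j : Fin 4 // j ≠ 3}))
local notation3 "vv" => (fun k : Fin 3 => chartGen x 3 (jJ3 k).1)
local notation3 "cc" => (Fin.cons (chartBase x 3 (x 3)) vv : Fin 4 → chartRing x 3)

/-- `jJ3` is injective. [folklore] -/
theorem jJ3_injective : Function.Injective jJ3 := fun _ _ h =>
  Fin.castSucc_injective _ (congrArg Subtype.val h)

omit [IsRegularLocalRing S] in
/-- `(c) = (u, e₀, e₁, e₂)`. [folklore] -/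
theorem span_range_cc :
    Ideal.span (Set.range cc) =
      Ideal.span {uu, chartGen x 3 0, chartGen x 3 1, chartGen x 3 2} := by
  rw [Fin.range_cons, Ideal.span_insert, Ideal.span_insert]
  congr 2
  ext y
  simp only [Set.mem_range, Set.mem_insert_iff, Set.mem_singleton_iff]
  constructor
  · rintro ⟨k, rfl⟩
    fin_cases k
    · exact Or.inl rfl
    · exact Or.inr (Or.inl rfl)
    · exact Or.inr (Or.inr rfl)
  · rintro (rfl | rfl | rfl)
    · exact ⟨0, rfl⟩
    · exact ⟨1, rfl⟩
    · exact ⟨2, rfl⟩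

omit [IsRegularLocalRing S] in
/-- The stage ideal `(u) + 0 + (e₀, e₁, e₂)` of the vertex chart is `(c)`. [folklore] -/
theorem chartStageIdeal_three_eq :
    chartStageIdeal x 3 ⊥ (Set.range (Fin.castSucc : Fin 3 → Fin 4)) =
      Ideal.span (Set.range cc) := by
  rw [chartStageIdeal, Ideal.map_bot, sup_bot_eq, Fin.range_cons, Ideal.span_insert,
    ← Set.range_comp]
  rfl

/-- `3 ∉ range castSucc`. [folklore] -/
theorem three_notMem_range_castSucc : (3 : Fin 4) ∉ Set.range (Fin.castSucc : Fin 3 → Fin 4) := by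
  rintro ⟨k, hk⟩
  exact castSucc_ne_three k hk

include hx hd in
/-- **`B₃ ⧸ (u, e₀, e₁, e₂) ≅ κ` is a domain** (the vertex is a `κ`-point).
[cite: StacksProject, Tag 0BIQ] -/
theorem isDomain_quot_span_range_cc : IsDomain (B ⧸ Ideal.span (Set.range cc)) := by
  haveI := isMaximal_span_rsop x hx
  haveI : IsDomain (S ⧸ (M ⊔ ⊥)) := by rw [sup_bot_eq]; exact Ideal.Quotient.isDomain _
  let ε := chartStageEquiv x 3 ⊥ (Set.range (Fin.castSucc : Fin 3 → Fin 4))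
    (isQuasiRegular_regularSystemOfParameters hd x hx) (three_notMem_range_castSucc)
  exact MulEquiv.isDomain _
    ((Ideal.quotEquivOfEq (chartStageIdeal_three_eq x).symm).toMulEquiv.trans ε.symm.toMulEquiv)

include hx hd in
/-- **The vertex chart: every blow-up of `Spec B₃` along `(K Q₀) B₃ = u⁵ · 𝔨 · 𝔫₀ · 𝔴` is
regular** — the abstract level two (`isRegular_of_isBlowup_kw_mul_span`) with `A = B₃`,
`t = u`, `v_k = e_k`, after twisting off `u⁵`. [cite: StacksProject, Tag 080A]
[cite: Liu2002, Thm. 8.1.19 (a)] -/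
theorem isRegular_of_isBlowup_map_KQ_three {Y : Scheme.{u}} {ρ : Y ⟶ Spec (.of B)}
    (hρ : IsBlowup ρ (affineBlowup.idealSheaf ((KK * QQ).map (chartBase x 3)))) :
    Scheme.IsRegular Y := by
  have hqr := isQuasiRegular_regularSystemOfParameters hd x hx
  haveI : IsRegularRing B := isRegularRing_chart x hx hd 3
  haveI := isRegularRing_residue x hx
  haveI : IsRegularRing (B ⧸ Ideal.span (Set.range cc)) :=
    isRegularRing_quot_cons_chartGen x 3 jJ3 hqr
  haveI : IsDomain (B ⧸ Ideal.span (Set.range cc)) := isDomain_quot_span_range_cc x hx hd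
  have hc : IsQuasiRegular cc := isQuasiRegular_cons_chartGen x 3 jJ3 hqr jJ3_injective
  have hreg1 : ∀ (k : Fin 3) (P : Ideal (B ⧸ Ideal.span {uu,
      chartGen x 3 0 * chartGen x 3 1 + chartGen x 3 2 ^ 2})) [P.IsPrime],
      Ideal.Quotient.mk _ (chartGen x 3 (Fin.castSucc k)) ∉ P →
        IsRegularLocalRing (Localization.AtPrime P) :=
    fun k P _ hP => isRegularLocalRing_quot_span_u_F_three x hx hd P k hP
  -- rewrite the total transform into the abstract level-two shape `u⁵ · ((𝔨 𝔴) · (c))`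
  rw [map_chartBase_KQ, ← span_range_cc, mul_comm (Ideal.span (Set.range cc)) _,
    ← mul_assoc (Ideal.span {uu, chartGen x 3 0 * chartGen x 3 1 + chartGen x 3 2 ^ 2})] at hρ
  have hu5 : uu ^ 5 ∈ nonZeroDivisors B :=
    pow_mem (reesChartBase_mem_nonZeroDivisors (x 3)
      (Ideal.mem_span_range_self (f := x) (x := 3))) 5
  exact isRegular_of_isBlowup_span_singleton_mul_of_forall hu5 _
    (fun Y' ρ' h' => isRegular_of_isBlowup_kw_mul_span (chartBase x 3 (x 3)) vv hc hreg1 h') hρ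

include hx hd in
/-- **Every blowing up of `Spec S` along `K · Q₀ · 𝔪` is regular** — `Bl_𝔪` and the four charts
(`isRegular_of_isBlowup_map_KQ_of_ne_three`, `isRegular_of_isBlowup_map_KQ_three`; chartwise
assembly, Stacks 080A). [cite: StacksProject, Tag 080A] [cite: Liu2002, Thm. 8.1.19 (a)] -/
theorem isRegular_of_isBlowup_KQM {Y : Scheme.{u}} {f : Y ⟶ Spec (.of S)}
    (hf : IsBlowup f (affineBlowup.idealSheaf ((KK * QQ) * M))) : Scheme.IsRegular Y := by
  refine isRegular_of_isBlowup_mul_of_charts x (KK * QQ) (fun i Y' ρ h => ?_) hf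
  by_cases hi : i = 3
  · subst hi
    exact isRegular_of_isBlowup_map_KQ_three x hx hd h
  · exact isRegular_of_isBlowup_map_KQ_of_ne_three x hx hd i hi h

include hx hd in
/-- **`K = (q) + 𝔪³` is in the companion class `𝒞`** with companion `Q₀ 𝔪 ⊇ 𝔪⁶`.
[cite: StacksProject, Tag 080A] -/
theorem companion_coneK :
    ∃ (Q : Ideal S) (m : ℕ), IsLocalRing.maximalIdeal S ^ m ≤ Q ∧
      ∃ (Y : Scheme.{u}) (b : Y ⟶ Spec (.of S)),
        IsBlowup b (affineBlowup.idealSheaf ((KK) * Q)) ∧ Scheme.IsRegular Y := by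
  obtain ⟨Y, b, hb⟩ := exists_isBlowup (Spec (.of S)) (affineBlowup.idealSheaf ((KK * QQ) * M))
  refine ⟨QQ * M, 6, ?_, Y, b, by rwa [← mul_assoc], isRegular_of_isBlowup_KQM x hx hd hb⟩
  rw [← hx, show (6 : ℕ) = 2 + 3 + 1 from rfl, pow_add, pow_add, pow_one]
  exact Ideal.mul_mono (Ideal.mul_mono le_sup_right le_sup_right) le_rfl

include hx hd in
/-- **CORE RUNG r2pt — the quadric-cone member.**  For `S` regular local with regular system of
parameters `x₀, …, x₃` and `I = (x₀³, x₁³, x₂³, x₃³, x₀x₁ + x₂²)`, every blowing up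
`T = Bl_I Spec S` satisfies the conclusion of the blow-up-form open core `AtomDimFourBlowupAt`:
`I` is a sup-reduction of `K = (q) + 𝔪³ ∈ 𝒞` (`(xᵢ³) · 𝔪⁶ = 𝔪⁹`).  Every characteristic, every residue field.
[cite: StacksProject, Tag 080A] [cite: Liu2002, Thm. 8.1.19 (a)] -/
theorem coreRung_cubesPlus_cone (T : Scheme.{u}) (f : T ⟶ Spec (.of S))
    (hf : IsBlowup f (affineBlowup.idealSheaf
      (Ideal.span (Set.range (fun i : Fin 4 => x i ^ 3) ∪ {x 0 * x 1 + x 2 ^ 2})))) :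
    ∃ (J : T.IdealSheafData) (T' : Scheme.{u}) (π : T' ⟶ T), J ≠ ⊥ ∧
      (∀ t : T, t ∈ J.support → f.base t = IsLocalRing.closedPoint S) ∧
      IsBlowup π J ∧ Scheme.IsRegular T' := by
  haveI : IsDomain S := isDomain_of_isRegularLocalRing S
  have hx0 : x 0 ≠ 0 := (isRsopPart_comp_of_rsop hd x hx id Function.injective_id).ne_zero 0
  -- the pigeonhole `(xᵢ³) · 𝔪⁶ = 𝔪⁹`
  have hred :
      Ideal.span (Set.range fun i : Fin 4 => x i ^ 3) * (M ^ 3) ^ 2 = (M ^ 3) ^ (2 + 1) := by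
    rw [← pow_mul, ← pow_mul, CoreRung.span_powers_mul_pow_eq_pow x rfl (by norm_num)]
  have hle : Ideal.span (Set.range fun i : Fin 4 => x i ^ 3) ≤ M ^ 3 := by
    rw [Ideal.span_le]
    rintro _ ⟨i, rfl⟩
    exact Ideal.pow_mem_pow (Ideal.subset_span (Set.mem_range_self i)) 3
  have hI :
      Ideal.span {x 0 * x 1 + x 2 ^ 2} ⊔ Ideal.span (Set.range fun i : Fin 4 => x i ^ 3) ≠ ⊥ :=
    fun h => pow_ne_zero 3 hx0 ((Submodule.eq_bot_iff _).mp h _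
      (Ideal.mem_sup_right (Ideal.subset_span
        (Set.mem_range_self (f := fun i : Fin 4 => x i ^ 3) 0))))
  have hKm : IsLocalRing.maximalIdeal S ^ 3 ≤ KK := by rw [← hx]; exact le_sup_right
  rw [Ideal.span_union, sup_comm] at hf
  exact coreRung_sup_reduction_of_companion hle hred hI hKm (companion_coneK x hx hd) T f hf

end Vertex

/-- **The `TargetR2pt` shape** (plan-1's `ChainW52TargetsC.lean`): dimension given as
`ringKrullDim S = 4` with a generating family `x` of length `4` (a regular system of parameters).
[cite: StacksProject, Tag 080A] [cite: Liu2002, Thm. 8.1.19 (a)] -/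
theorem coreRung_cubesPlus_cone_of_ringKrullDim {S : Type u} [CommRing S] [IsRegularLocalRing S]
    (x : Fin 4 → S) (hx : Ideal.span (Set.range x) = IsLocalRing.maximalIdeal S)
    (hdim : ringKrullDim S = (4 : ℕ)) (T : Scheme.{u}) (f : T ⟶ Spec (.of S))
    (hf : IsBlowup f (affineBlowup.idealSheaf
      (Ideal.span (Set.range (fun i : Fin 4 => x i ^ 3) ∪ {x 0 * x 1 + x 2 ^ 2})))) :
    ∃ (J : T.IdealSheafData) (T' : Scheme.{u}) (π : T' ⟶ T), J ≠ ⊥ ∧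
      (∀ t : T, t ∈ J.support → f.base t = IsLocalRing.closedPoint S) ∧
      IsBlowup π J ∧ Scheme.IsRegular T' := by
  have hd : (IsLocalRing.maximalIdeal S).spanFinrank = 4 := by
    have h := IsRegularLocalRing.spanFinrank_maximalIdeal (R := S)
    rw [hdim] at h
    exact_mod_cast h
  exact coreRung_cubesPlus_cone x hx hd T f hf

/-- **The registered core's binder shape, restricted to the member** (hypotheses of
`stub_atomDimFourBlowup`; characteristic, completeness, residue field and the off-fibre hypothesis
unused). [cite: StacksProject, Tag 080A] [cite: Liu2002, Thm. 8.1.19 (a)] -/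
theorem atomDimFourBlowupAt_cubesPlus_cone (p : ℕ) (_hp : p.Prime) (S : Type) [CommRing S]
    [IsRegularLocalRing S] [CharP S p] [IsAdicComplete (IsLocalRing.maximalIdeal S) S]
    [PerfectField (IsLocalRing.ResidueField S)] (hS : ringKrullDim S = (4 : ℕ))
    (x : Fin 4 → S) (hx : Ideal.span (Set.range x) = IsLocalRing.maximalIdeal S)
    (T : Scheme.{0}) (f : T ⟶ Spec (.of S))
    (hf : IsBlowup f (affineBlowup.idealSheaf
      (Ideal.span (Set.range (fun j : Fin 4 => x j ^ 3) ∪ {x 0 * x 1 + x 2 ^ 2}))))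
    (_hoff : ∀ t : T, f.base t ≠ IsLocalRing.closedPoint S →
      IsRegularLocalRing (T.presheaf.stalk t)) :
    ∃ (J : T.IdealSheafData) (T' : Scheme.{0}) (π : T' ⟶ T), J ≠ ⊥ ∧
      (∀ t : T, t ∈ J.support → f.base t = IsLocalRing.closedPoint S) ∧
      IsBlowup π J ∧ Scheme.IsRegular T' :=
  coreRung_cubesPlus_cone_of_ringKrullDim x hx hS T f hf

end ConeRung

end Summit.ResolutionOfSingularities.ResolutionOfSingularities.Theorems

end
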